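import Summits.QuantumAdvantage.QuantumAdvantage.Theses.YangBaxterIslands
import Literature.Computability.Complexity.CircuitLowerBoundsIW
import Literature.Computability.Complexity.CircuitClassesUniformProofs
import Literature.Computability.Complexity.ProbabilisticClassesProofs
import Literature.Computability.Cryptography.ShorAssemblyLeavesProofs
import Literature.Computability.Complexity.ScaledPCPAssembly
import Literature.Computability.MetaComplexity.AvgCaseDerandomizationPCP

/-!
# CensusSketch — the REJECTED decompositions of `YbTarget`, typed, each with the kernel-checked reason it fails
(a) load-bearing / (b) non-trivial proved seam / (c) no piece gives S or X on its own.
Companion of `STRATEGY-CENSUS.md` (crux stmt-QuantumAdvantage-2545, strategist r1). Everything here is sorry-free.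
-/

namespace Summit.QuantumAdvantage.QuantumAdvantage.Cruxes.YbTarget.CensusSketch

open Summit.QuantumAdvantage.QuantumAdvantage.Theses.YangBaxterIslands

/-- piece of the FILED cut (for comparison) -/
def YbNotP : Prop :=
  ∃ L : Language Bool, (∃ a b : ℚ, ∃ (f : List Bool → List Bool) (p q : Polynomial ℕ), f ∈ Literature.Computability.Complexity.FP ∧ ∃ F : Literature.Computability.Cryptography.QCircuitFamily (⟨Unit, fun _ => 2, fun _ => Matrix.of fun u v : Fin 2 → Bool => if u 0 = u 1 then (if v = u then Complex.exp (-((((b : ℝ) * Real.pi) : ℝ) : ℂ) * Complex.I) else 0) else if v 0 = v 1 then 0 else Complex.exp (((((b : ℝ) * Real.pi) : ℝ) : ℂ) * Complex.I) * (if v = u then ((Real.cos (2 * ((a : ℝ) * Real.pi)) : ℝ) : ℂ) else -(Complex.I * ((Real.sin (2 * ((a : ℝ) * Real.pi)) : ℝ) : ℂ)))⟩ : Literature.Computability.Cryptography.QGateSet), F = ⟨fun n => p.eval n, fun n => ⟨(List.range (q.eval n)).flatMap fun s => (List.range (n + p.eval n)).filterMap fun j => if h : j % 2 = s % 2 ∧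 j + 1 < (n + p.eval n) then some (Literature.Computability.Cryptography.QGate.gate () ⟨fun i : Fin 2 => ⟨j + i.val, by have := i.isLt; omega⟩, fun i i' hh => Fin.ext (by simp only [Fin.mk.injEq] at hh; omega)⟩) else none⟩⟩ ∧ ∀ x : List Bool, (x ∈ L → (2 : ℝ) / 3 ≤ F.acceptProbOn 0 (f x)) ∧ (x ∉ L → F.acceptProbOn 0 (f x) ≤ 1 / 3)) ∧ L ∉ Literature.Computability.Complexity.Classes.P

/-! ### D2 — `(P = BPP) ∧ YbNotP`: the derandomization cut with the CONCLUSION of IW97 as the piece.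
Valid and weakest, but the seam is pure rewriting — violates (b) (trivial seam). The filed cut replaces `P = BPP`
by its root hypothesis `YbEHard` and the seam by the tree's Impagliazzo–Wigderson theorem. -/
def PeqBPP : Prop :=
  Literature.Computability.Complexity.Classes.P = Literature.Computability.Complexity.BPP

theorem D2_trivialSeam (h₁ : PeqBPP) (h₂ : YbNotP) : YbTarget := by
  obtain ⟨L, hL, hLP⟩ := h₂
  exact ⟨L, hL, h₁ ▸ hLP⟩

/-! ### D3 — `YbHardness ∧ QuantumAdvantage` (the route's own `YbHardnessTransfer`): piece 2 IS the Statement —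
violates (c) outright. -/
theorem D3_pieceIsS (hH : YbHardness) (hS : _root_.QuantumAdvantage) : YbTarget := by
  obtain ⟨L, hL, hLB⟩ := hS
  exact ⟨L, hH hL, hLB⟩

/-! ### D4 — `(FACT ∈ XXZBQP) ∧ (FACT ∉ BPP)` ("Shor on the integrable brickwork" + classical hardness of
factoring): trivial seam (b), and piece 2 gives S ON ITS OWN through the tree theorem `FACT_mem_BQP_holds`
(Shor) — violates (c). -/
def FactInXXZ : Prop :=
  Literature.Computability.QuantumComplexity.FACT ∈ {L : Language Bool | ∃ a b : ℚ, ∃ (f : List Bool → List Bool) (p q : Polynomial ℕ), f ∈ Literature.Computability.Complexity.FP ∧ ∃ F : Literature.Computability.Cryptography.QCircuitFamily (⟨Unit, fun _ => 2, fun _ => Matrix.of fun u v : Fin 2 → Bool => if u 0 = u 1 then (if v = u then Complex.exp (-((((b : ℝ) * Real.pi) : ℝ) : ℂ) * Complex.I) else 0) else if v 0 = v 1 then 0 else Complex.exp (((((b : ℝ) * Real.pi) : ℝ) : ℂ) * Complex.I) * (if v = u then ((Real.cos (2 * ((a : ℝ) * Real.pi)) : ℝ) : ℂ) else -(Complex.I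 * ((Real.sin (2 * ((a : ℝ) * Real.pi)) : ℝ) : ℂ)))⟩ : Literature.Computability.Cryptography.QGateSet), F = ⟨fun n => p.eval n, fun n => ⟨(List.range (q.eval n)).flatMap fun s => (List.range (n + p.eval n)).filterMap fun j => if h : j % 2 = s % 2 ∧ j + 1 < (n + p.eval n) then some (Literature.Computability.Cryptography.QGate.gate () ⟨fun i : Fin 2 => ⟨j + i.val, by have := i.isLt; omega⟩, fun i i' hh => Fin.ext (by simp only [Fin.mk.injEq] at hh; omega)⟩) else none⟩⟩ ∧ ∀ x : List Bool, (x ∈ L → (2 : ℝ) / 3 ≤ F.acceptProbOn 0 (f x)) ∧ (x ∉ L → F.acceptProbOn 0 (f x) ≤ 1 / 3)}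

def FactNotBPP : Prop :=
  Literature.Computability.QuantumComplexity.FACT ∉ Literature.Computability.Complexity.BPP

theorem D4_trivialSeam (h₁ : FactInXXZ) (h₂ : FactNotBPP) : YbTarget :=
  ⟨_, h₁, h₂⟩

theorem D4_piece2_gives_S (h₂ : FactNotBPP) : _root_.QuantumAdvantage :=
  ⟨_, Literature.Computability.Cryptography.FACT_mem_BQP_holds, h₂⟩

/-! ### D5 — `XXZBQP ⊄ P/poly`: with Adleman's theorem `BPP ⊆ P/poly` (tree: `BPP_subset_PPoly_holds`) this single
piece already gives X — it is a STRENGTHENING of X (k = 1), not a decomposition; violates (a)/(c). -/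
def XXZNotPPoly : Prop :=
  ∃ L : Language Bool, L ∈ {L : Language Bool | ∃ a b : ℚ, ∃ (f : List Bool → List Bool) (p q : Polynomial ℕ), f ∈ Literature.Computability.Complexity.FP ∧ ∃ F : Literature.Computability.Cryptography.QCircuitFamily (⟨Unit, fun _ => 2, fun _ => Matrix.of fun u v : Fin 2 → Bool => if u 0 = u 1 then (if v = u then Complex.exp (-((((b : ℝ) * Real.pi) : ℝ) : ℂ) * Complex.I) else 0) else if v 0 = v 1 then 0 else Complex.exp (((((b : ℝ) * Real.pi) : ℝ) : ℂ) * Complex.I) * (if v = u then ((Real.cos (2 * ((a : ℝ) * Real.pi)) : ℝ) : ℂ) else -(Complex.I * ((Real.sin (2 * ((a : ℝ) * Real.pi)) : ℝ) : ℂ)))⟩ : Literature.Computability.Cryptography.QGateSet), F = ⟨fun n => p.eval n, fun n => ⟨(List.range (q.eval n)).flatMap fun s => (List.range (n + p.eval n)).filterMap fun j => if h : j % 2 = s % 2 ∧ j + 1 < (n + p.eval n) then some (Literature.Computability.Cryptography.QGate.gate () ⟨fun i : Fin 2 => ⟨j + i.val, by have := i.isLt; omega⟩, fun i i' hh => Fin.ext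 (by simp only [Fin.mk.injEq] at hh; omega)⟩) else none⟩⟩ ∧ ∀ x : List Bool, (x ∈ L → (2 : ℝ) / 3 ≤ F.acceptProbOn 0 (f x)) ∧ (x ∉ L → F.acceptProbOn 0 (f x) ≤ 1 / 3)} ∧ L ∉ Literature.Computability.Complexity.PPoly

theorem D5_singlePieceGivesX (h : XXZNotPPoly) : YbTarget := by
  obtain ⟨L, hL, hLPP⟩ := h
  exact ⟨L, hL, fun hB => hLPP (Literature.Computability.Complexity.BPP_subset_PPoly_holds hB)⟩

/-! ### D6 — `(XXZBQP ∩ BPP ⊆ P) ∧ YbNotP` ("dequantizable brickwork languages are derandomizable" + the brickwork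
beats P): the family-restricted derandomization piece is the WEAKEST possible partner of `YbNotP` (it is implied by
`P = BPP`), but the seam is two lines of logic — violates (b); and piece 1 has no source, no attack and no refutation
surface short of `XXZBQP ⊆ P` (it is true if X holds vacuously-in-spirit: then it constrains only the easy languages). -/
def XXZDerand : Prop :=
  {L : Language Bool | ∃ a b : ℚ, ∃ (f : List Bool → List Bool) (p q : Polynomial ℕ), f ∈ Literature.Computability.Complexity.FP ∧ ∃ F : Literature.Computability.Cryptography.QCircuitFamily (⟨Unit, fun _ => 2, fun _ => Matrix.of fun u v : Fin 2 → Bool => if u 0 = u 1 then (if v = u then Complex.exp (-((((b : ℝ) * Real.pi) : ℝ) : ℂ) * Complex.I) else 0) else if v 0 = v 1 then 0 else Complex.exp (((((b : ℝ) * Real.pi) : ℝ) : ℂ) * Complex.I) * (if v = u then ((Real.cos (2 * ((a : ℝ) * Real.pi)) : ℝ) : ℂ) else -(Complex.I * ((Real.sin (2 * ((a : ℝ) * Real.pi)) : ℝ) : ℂ)))⟩ : Literature.Computability.Cryptography.QGateSet), F = ⟨fun n => p.eval n, fun n => ⟨(List.range (q.eval n)).flatMap fun s => (List.range (n + p.eval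 n)).filterMap fun j => if h : j % 2 = s % 2 ∧ j + 1 < (n + p.eval n) then some (Literature.Computability.Cryptography.QGate.gate () ⟨fun i : Fin 2 => ⟨j + i.val, by have := i.isLt; omega⟩, fun i i' hh => Fin.ext (by simp only [Fin.mk.injEq] at hh; omega)⟩) else none⟩⟩ ∧ ∀ x : List Bool, (x ∈ L → (2 : ℝ) / 3 ≤ F.acceptProbOn 0 (f x)) ∧ (x ∉ L → F.acceptProbOn 0 (f x) ≤ 1 / 3)} ∩ Literature.Computability.Complexity.BPP ⊆ Literature.Computability.Complexity.Classes.P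

theorem D6_trivialSeam (h₁ : XXZDerand) (h₂ : YbNotP) : YbTarget := by
  obtain ⟨L, hL, hLP⟩ := h₂
  exact ⟨L, hL, fun hB => hLP (h₁ ⟨hL, hB⟩)⟩

theorem D6_piece1_of_PeqBPP (h : PeqBPP) : XXZDerand :=
  fun _ hL => h ▸ hL.2

/-! ### D1′ — same seam as the filed cut but with the only OTHER in-tree sufficient condition for `P = BPP` of a
different kind: Heuristica (`DistNP ⊆ AvgP`, Buhrman–Fortnow–Pavan 2005; tree: PCPs for `E` + BFP win-win, all
proved). A PROVED non-trivial seam, but the piece is widely disbelieved — useless as a crux. -/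
theorem D1'_heuristicaSeam (hD : Literature.Computability.MetaComplexity.DistNP ⊆ Literature.Computability.MetaComplexity.AvgP) (h₂ : YbNotP) : YbTarget := by
  have hE := Literature.Computability.MetaComplexity.exists_hard_E_of_DistNP_subset_AvgP_of_pcp
    Literature.Computability.Complexity.ScaledPCP.exists_pcp_of_mem_E hD
  have hPBPP := Literature.Computability.Complexity.impagliazzo_wigderson_holds hE
  obtain ⟨L, hL, hLP⟩ := h₂
  exact ⟨L, hL, hPBPP ▸ hLP⟩

/-! ### D8 — three pieces `YbEHard ∧ YbHardness ∧ (BQP ⊄ P)`: valid, every piece open and none gives S or X alone,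
but at ROUTE level `S` then follows from `YbEHard ∧ (BQP ⊄ P)` WITHOUT the brickwork (below), i.e. the Yang–Baxter
content idles in the derivation of S — recorded as the foreseen sub-factoring of `YbNotP`, not filed. -/
def BqpNotP : Prop :=
  ∃ L : Language Bool, L ∈ Literature.Computability.Cryptography.BQP ∧ L ∉ Literature.Computability.Complexity.Classes.P

theorem D8_S_bypasses_brickwork (hE : ∃ L ∈ Literature.Computability.Complexity.E, ∃ ε : ℝ, 0 < ε ∧ ∀ᶠ n : ℕ in Filter.atTop, (2 : ℝ) ^ (ε * n) ≤ (L.circuitSize n : ℝ)) (hB : BqpNotP) : _root_.QuantumAdvantage := by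
  have hPBPP := Literature.Computability.Complexity.impagliazzo_wigderson_holds hE
  obtain ⟨L, hL, hLP⟩ := hB
  exact ⟨L, hL, hPBPP ▸ hLP⟩

end Summit.QuantumAdvantage.QuantumAdvantage.Cruxes.YbTarget.CensusSketch
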